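import Summits.ABC.IUTFork.Conditional.WRowFrey343AllLevels
import Summits.ABC.IUTFork.Conditional.WRowFrey283AllLevels
import Summits.ABC.IUTFork.Conditional.WRowReyssatAllLevels
import Summits.ABC.IUTFork.Conditional.AbcOfSGenuineKLicence
import Summits.ABC.IUTFork.Cor312ThetaSideClosedK
import Summits.ABC.IUTFork.Cor312SettingDHVolWitness
import Summits.ABC.IUTFork.Cor312ProvKIdeles
import HarnessLib

/-!
# Branch C — the NUMBER-LEVEL typed [IUTchIII] Cor. 3.12 in READING (U) (`T.Cor312Of`) EVALUATES TRUE, with NO hypothesis, at EVERY genuine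
# Θ-volume datum of THREE known abc triples AT EVERY (high enough) PRIME LEVEL: `7³ + 3¹⁰ = 2¹¹·29` (all `l ≥ 5`), `283 + 5¹¹·13² = 2⁸·3⁸·17³`
# (all `l ≥ 13`), Reyssat `2 + 3¹⁰·109 = 23⁵` (all `l ≥ 167`)

C scoreboard (abc-iut-C-cert-3 gen 4, INTAKE / CERTS pen). PROOF-ONLY junction file (no `def`, no new `Prop`, no instance, no notation; nothing
re-typed); the uniform-in-`l` sequel of `AbcOfSCor312OfFrey283` (p484566). WHY: abc-iut-W-row-1 gen 2's «W:INHABITED-BANDS-A» (abc-iut-plan C-R75 (1) /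
C-R77) decides the INHABITED side of the letter-W table per triple by ONE theorem for all levels — `WRow.licence_frey343_all` (every prime `l ≥ 5`),
`WRow.licence_frey283_all` (`l ≥ 13`), `WRow.licence_reyssat_all` (`l ≥ 167`) over the generic socket `WRow.licence_triple_unconditional` (p485974):
the hull licence S_H HOLDS at the K-level genuine sharp setting of EVERY genuine Θ-volume datum, for EVERY choice of the free context binders and EVERY
pair of realising ideles. As in p484566, abc-iut-C-cert-3's `GenuineK.cor312Of_of_licence` (p435505) and abc-iut-s2-p6's Θ-descent
`negLogTheta_settingPrVolSharp_pilotDataOfK_le_datum` (p447368) turn each licence into the datum's NUMBER-level Corollary `T.Cor312Of`, the free binders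
being instantiated at one-point data (abc-iut-c312-7's `unitSigDH/unitSplitDH/unitQDataDH/unitLatticeDH`, `M := ℚ`) and at the realising ideles of
[IUTchI] Ex. 3.2 (iv) (`Cor312Prov.exists_realising_{q,theta}Ideles_pilotDataOfK`):

* `Frey343.cor312Of_all (l) (hl : l.Prime) (hl0 : 5 ≤ l) : ∀ T : ThetaVolumeDatumAt (ratPoint (343/59392)) l, T.Cor312Of` — the ENTIRE λ-fibre;
* `Frey283.cor312Of_all (l) (hl : l.Prime) (hl0 : 13 ≤ l) : ∀ T …, T.Cor312Of`;
* `Reyssat.cor312Of_all (l) (hl : l.Prime) (hl0 : 167 ≤ l) : ∀ T …, T.Cor312Of`.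

READING (numbers, no side): LINE-FREE — `T.Cor312Of` is the very proposition the K AND the M number binders (hNum*/hNumOff*/hNumJoint* and their M
twins) demand at T, so on these (λ, l)-families the number-binder instances of BOTH lines are theorems; for `7³ + 3¹⁰ = 2¹¹·29` this is EVERY
admissible level. The typed (U)-form is a STRONGER reading of [IUTchIII] Cor 3.12 than the per-image form (P) of FINDINGS §O. This says NOTHING about
Cor 3.12 in print, derives NO height bound (the [IUTchIV] 1.10 display at a known triple carries a constant ≈ 10⁸ nats; the cone binder `hregBad` is
untouched, C-R52), and is not a claim that abc is proved or refuted; no side taken on any author (Mochizuki / Scholze–Stix / Joshi / Dupuy–Hilado);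
inhabited-as-typed ≠ true-in-print; typed ≠ proved; instantiated ≠ endorsed.
[cite: Mochizuki2012, IUTchIII Cor. 3.12 p. 173–174, Step (xi-f) p. 184; IUTchIV Thm. 1.10 p. 22–23, Cor. 2.2 (ii) proof (P5)(P7) p. 46; IUTchI Ex. 3.2 (iv) p. 71]
[cite: DupuyHilado2025, §3.3, §3.4] [claim: Mochizuki2012, status: disputed] for every IUT sentence quoted.
-/

noncomputable section

open Set Function NumberField IsDedekindDomain

namespace Summit.ABC.IUTFork.Conditional

open Thm311 Thm311.Real Cor312 Cor312Vol Cor312Prov Literature.IUT.LogThetaLattice Literature.IUT.LogVolume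
  Literature.IUT.HodgeTheaters Literature.IUT.LogVolume.ThetaData Literature.IUT.LogVolume.Cor22
open Literature.NumberTheory.NumberFields Literature.NumberTheory.GaloisRepresentations.Ultrametric
open Literature.NumberTheory.DiophantineGeometry Literature.NumberTheory.DiophantineGeometry.GenEll Summit.ABC.ABC.Theorems

/-- **`T.Cor312Of` at EVERY genuine Θ-volume datum over `(ratPoint (343/59392), l)` for EVERY prime `l ≥ 5`, NO hypothesis** — the abc triple
`7³ + 3¹⁰ = 2¹¹·29` at EVERY level: abc-iut-W-row-1's `WRow.licence_frey343_all` («W:INHABITED-BANDS-A», ONE theorem for all levels) at one-point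
context data and the realising ideles of [IUTchI] Ex. 3.2 (iv), through `GenuineK.cor312Of_of_licence` (p435505) and the K-level Θ-side descent
(p447368). The ENTIRE `λ`-FIBRE `{(ratPoint (343/59392), l) : l ≥ 5 prime}` of the window certificates' number binders is thereby a THEOREM.
[cite: Mochizuki2012, IUTchIII Cor. 3.12 p. 173–174; IUTchIV Cor. 2.2 (ii) proof (P5) p. 46] [claim: Mochizuki2012, status: disputed] -/
theorem Frey343.cor312Of_all (l : ℕ) (hl : l.Prime) (hl0 : 5 ≤ l) (T : Cor22.ThetaVolumeDatumAt (ratPoint (((343 : ℕ) : ℚ) / (59392 : ℕ))) l) : T.Cor312Of := by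
  letI := T.instFieldF; letI := T.instNumberFieldF; letI := T.instAlgebraF; letI := T.instFieldK
  letI := T.instNumberFieldK; letI := T.instAlgebraK; letI := T.instFieldFbar; letI := T.instAlgebraFbar
  letI := T.instAlgebraKFbar; letI := T.instIsElliptic
  obtain ⟨tq, htq0, htq1, htq⟩ := exists_realising_qIdeles_pilotDataOfK T.D
  obtain ⟨t, ht0, ht1, ht⟩ := exists_realising_thetaIdeles_pilotDataOfK T.D
  exact GenuineK.cor312Of_of_licence T.D T.K ℚ (fun _ _ => ∅) (fun _ _ => ∅) (fun _ _ _ => ∅) (fun _ _ _ => 0) (fun _ _ => ∅)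
    (fun _ _ _ _ => ∅) 0 unitLatticeDH (unitSigDH (pilotDataOfK T.D T.K)) (unitSplitDH (pilotDataOfK T.D T.K))
    (unitQDataDH (pilotDataOfK T.D T.K)) t tq T.isVolumeInputOf htq0 htq1 ht0 ht1 htq
    (WRow.licence_frey343_all l hl hl0 T (logvAnalytic_analyticLogv (F := T.K)) ℚ (fun _ _ => ∅) (fun _ _ => ∅) (fun _ _ _ => ∅)
      (fun _ _ _ => 0) (fun _ _ => ∅) (fun _ _ _ _ => ∅) 0 unitLatticeDH (unitSigDH (pilotDataOfK T.D T.K)) (unitSplitDH (pilotDataOfK T.D T.K))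
      (unitQDataDH (pilotDataOfK T.D T.K)) tq t htq0 htq1 ht0 ht htq)
    (negLogTheta_settingPrVolSharp_pilotDataOfK_le_datum T ℚ (fun _ _ => ∅) (fun _ _ => ∅) (fun _ _ _ => ∅) (fun _ _ _ => 0) (fun _ _ => ∅)
      (fun _ _ _ _ => ∅) 0 unitLatticeDH (unitSigDH (pilotDataOfK T.D T.K)) (unitSplitDH (pilotDataOfK T.D T.K)) (unitQDataDH (pilotDataOfK T.D T.K))
      tq t htq0 htq1 ht0 ht)

/-- **`T.Cor312Of` at EVERY genuine Θ-volume datum over `(ratPoint (283/8251953408), l)` for EVERY prime `l ≥ 13`, NO hypothesis** — the abc triple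
`283 + 5¹¹·13² = 2⁸·3⁸·17³`: abc-iut-W-row-1's `WRow.licence_frey283_all` through `GenuineK.cor312Of_of_licence` + p447368 (supersedes the three
single levels 13/17/19 of `AbcOfSCor312OfFrey283`, p484566, as a uniform statement). [cite: Mochizuki2012, IUTchIII Cor. 3.12 p. 173–174;
IUTchIV Cor. 2.2 (ii) proof (P5) p. 46] [claim: Mochizuki2012, status: disputed] -/
theorem Frey283.cor312Of_all (l : ℕ) (hl : l.Prime) (hl0 : 13 ≤ l) (T : Cor22.ThetaVolumeDatumAt (ratPoint (((283 : ℕ) : ℚ) / (8251953408 : ℕ))) l) : T.Cor312Of := by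
  letI := T.instFieldF; letI := T.instNumberFieldF; letI := T.instAlgebraF; letI := T.instFieldK
  letI := T.instNumberFieldK; letI := T.instAlgebraK; letI := T.instFieldFbar; letI := T.instAlgebraFbar
  letI := T.instAlgebraKFbar; letI := T.instIsElliptic
  obtain ⟨tq, htq0, htq1, htq⟩ := exists_realising_qIdeles_pilotDataOfK T.D
  obtain ⟨t, ht0, ht1, ht⟩ := exists_realising_thetaIdeles_pilotDataOfK T.D
  exact GenuineK.cor312Of_of_licence T.D T.K ℚ (fun _ _ => ∅) (fun _ _ => ∅) (fun _ _ _ => ∅) (fun _ _ _ => 0) (fun _ _ => ∅)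
    (fun _ _ _ _ => ∅) 0 unitLatticeDH (unitSigDH (pilotDataOfK T.D T.K)) (unitSplitDH (pilotDataOfK T.D T.K))
    (unitQDataDH (pilotDataOfK T.D T.K)) t tq T.isVolumeInputOf htq0 htq1 ht0 ht1 htq
    (WRow.licence_frey283_all l hl hl0 T (logvAnalytic_analyticLogv (F := T.K)) ℚ (fun _ _ => ∅) (fun _ _ => ∅) (fun _ _ _ => ∅)
      (fun _ _ _ => 0) (fun _ _ => ∅) (fun _ _ _ _ => ∅) 0 unitLatticeDH (unitSigDH (pilotDataOfK T.D T.K)) (unitSplitDH (pilotDataOfK T.D T.K))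
      (unitQDataDH (pilotDataOfK T.D T.K)) tq t htq0 htq1 ht0 ht htq)
    (negLogTheta_settingPrVolSharp_pilotDataOfK_le_datum T ℚ (fun _ _ => ∅) (fun _ _ => ∅) (fun _ _ _ => ∅) (fun _ _ _ => 0) (fun _ _ => ∅)
      (fun _ _ _ _ => ∅) 0 unitLatticeDH (unitSigDH (pilotDataOfK T.D T.K)) (unitSplitDH (pilotDataOfK T.D T.K)) (unitQDataDH (pilotDataOfK T.D T.K))
      tq t htq0 htq1 ht0 ht)

/-- **`T.Cor312Of` at EVERY genuine Θ-volume datum over the REYSSAT point `(ratPoint (2/23⁵), l)` for EVERY prime `l ≥ 167`, NO hypothesis** —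
abc-iut-W-row-1's `WRow.licence_reyssat_all` through `GenuineK.cor312Of_of_licence` + p447368. (At `l = 13` the window clause at Reyssat is REFUTED on
both lines, FINDINGS §Q; the number-level (U) statement here concerns the high levels where S_H is INHABITED.) [cite: Mochizuki2012, IUTchIII Cor. 3.12
p. 173–174; IUTchIV Cor. 2.2 (ii) proof (P5) p. 46] [claim: Mochizuki2012, status: disputed] -/
theorem Reyssat.cor312Of_all (l : ℕ) (hl : l.Prime) (hl0 : 167 ≤ l) (T : Cor22.ThetaVolumeDatumAt (ratPoint (((2 : ℕ) : ℚ) / (6436343 : ℕ))) l) : T.Cor312Of := by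
  letI := T.instFieldF; letI := T.instNumberFieldF; letI := T.instAlgebraF; letI := T.instFieldK
  letI := T.instNumberFieldK; letI := T.instAlgebraK; letI := T.instFieldFbar; letI := T.instAlgebraFbar
  letI := T.instAlgebraKFbar; letI := T.instIsElliptic
  obtain ⟨tq, htq0, htq1, htq⟩ := exists_realising_qIdeles_pilotDataOfK T.D
  obtain ⟨t, ht0, ht1, ht⟩ := exists_realising_thetaIdeles_pilotDataOfK T.D
  exact GenuineK.cor312Of_of_licence T.D T.K ℚ (fun _ _ => ∅) (fun _ _ => ∅) (fun _ _ _ => ∅) (fun _ _ _ => 0) (fun _ _ => ∅)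
    (fun _ _ _ _ => ∅) 0 unitLatticeDH (unitSigDH (pilotDataOfK T.D T.K)) (unitSplitDH (pilotDataOfK T.D T.K))
    (unitQDataDH (pilotDataOfK T.D T.K)) t tq T.isVolumeInputOf htq0 htq1 ht0 ht1 htq
    (WRow.licence_reyssat_all l hl hl0 T (logvAnalytic_analyticLogv (F := T.K)) ℚ (fun _ _ => ∅) (fun _ _ => ∅) (fun _ _ _ => ∅)
      (fun _ _ _ => 0) (fun _ _ => ∅) (fun _ _ _ _ => ∅) 0 unitLatticeDH (unitSigDH (pilotDataOfK T.D T.K)) (unitSplitDH (pilotDataOfK T.D T.K))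
      (unitQDataDH (pilotDataOfK T.D T.K)) tq t htq0 htq1 ht0 ht htq)
    (negLogTheta_settingPrVolSharp_pilotDataOfK_le_datum T ℚ (fun _ _ => ∅) (fun _ _ => ∅) (fun _ _ _ => ∅) (fun _ _ _ => 0) (fun _ _ => ∅)
      (fun _ _ _ _ => ∅) 0 unitLatticeDH (unitSigDH (pilotDataOfK T.D T.K)) (unitSplitDH (pilotDataOfK T.D T.K)) (unitQDataDH (pilotDataOfK T.D T.K))
      tq t htq0 htq1 ht0 ht)

end Summit.ABC.IUTFork.Conditional

end
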